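import Summits.HubbardSuperconductivity.HubbardSuperconductivity.Theses.ParentFirstSMA
import Literature.MathematicalPhysics.QuantumLattice.PairFieldYangCeiling
import Literature.MathematicalPhysics.QuantumLattice.HubbardWave0RayleighProofs
import Literature.MathematicalPhysics.QuantumLattice.HubbardWave0PosSemidefProofs
import Literature.MathematicalPhysics.QuantumLattice.PairCorrelationsDWaveSymmetryProofs
import HarnessLib

/-!
# Stub `stub_condensateDWaveLocking` of line `birth`, crux `DiluteDWavePairsCondense` (stmt-HubbardSuperconductivity-10771)

WORKER NOTES (formal settle-or-diagnose; outcome `stub-blocked: none-in-tree`, see §(3) of this header).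
`lean check --json` of this file: rc 0, errors [], warnings [], sorries 0 (2026-08-17); the helper
theorems below are sorry-free (they are NOT the stub); landed by the lead (c14) as an audit helper
`--supports stmt-HubbardSuperconductivity-10771` under the registered sub-goal
`condensateDWaveLocking_vacuous_above_yang`.

The stub: for every `U ∈ [12, 24]`, (b) two-hole binding and (c) `d`-coherence of the bound pair
imply `∃ δ₁ > 0, ∀ δ ∈ (0, δ₁], ∀ c > 0, ∃ c' > 0, ∃ L₀, ∀ L ≥ L₀ even, ∀ unit sector ground state
ψ at (2⌊(1-δ)L²/2⌋, S^z = 0)`, IF `ρ₂(ψ)` has a unit eigenvector with eigenvalue `≥ c L²` THEN it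
has one with eigenvalue `≥ c L²` AND `c' L² ≤ ‖⟨v, φ_d⟩‖²`.

## (1) A-priori ceiling (Yang) — what IS provable, and the threshold

`IsGroundStateInSector H N 0 ψ` gives `ψ ∈ szSector N 0`, hence `IsNParticle N ψ`
(`mem_szSector_iff`), with `N = 2⌊(1-δ)L²/2⌋` even and `N ≤ (1-δ)L² ≤ 2L² = card (Orb _)`.
For a unit eigenvector `ρ₂ v = ev • v`, `ev = re ⟨v, ρ₂ v⟩ ≤ N(M - N + 2)/M` (Yang,
`twoParticleRDM_rayleigh_le_holds`, `M = 2L²`), and `n ↦ n(M + 2 - n)` is increasing on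
`[0, L² + 1] ∋ (1-δ)L²`, so `ev ≤ (1-δ)((1+δ)L² + 2)/2 = (1-δ²)L²/2 + (1-δ)`.
Hence for `c > (1 - δ²)/2` the antecedent `c L² ≤ ev` is unsatisfiable once
`(c - (1-δ²)/2) L² > 1 - δ`, and the inner implication is vacuously true: PROVED below as
`condensateDWaveLocking_of_yang_threshold` (sorry-free; `c' = 1`). Uniformly in `δ ∈ [0, 1]`:
every `c > 1/2` is vacuous. For `0 < c ≤ (1-δ²)/2` Yang's bound does not exclude the antecedent
(and Yang's bound is attained by his extreme states, `exists_twoParticleRDM_rayleigh_eq_holds`, so no sharper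
a-priori ceiling can exist), so NO case split
on `c` proves the stub: the quantifier order `∀ c > 0, ∃ c' ∃ L₀ ∀ L` forces the small-`c` case, whose
truth depends on the actual sector ground states of `hubbardTorus 2 L 1 U` at hole density `δ > 0`.
The hypotheses (b), (c) speak about the sectors `L², L² - 1, L² - 2` only; for `δ > 0` fixed and
`L → ∞` (`∀ L ≥ L₀` always contains such `L`) the sector `2⌊(1-δ)L²/2⌋ < L² - 2` is disjoint from
them, so (b), (c) are formally inert (they cannot be refuted a priori either: `|⟨φ₂, Δ_d ψ₀⟩|² ≤
‖Δ_d ψ₀‖² ≤ 2L²(L²+2)` by `re_expect_pairField_dWave_conjTranspose_mul_le_yang` is compatible with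
`z L²`, and `2E(L²-1) - E(L²) - E(L²-2)` has no a-priori sign).

## (2) Formal falsity — not available

The conclusion is CONDITIONAL on a macroscopic `ρ₂`-eigenvalue of an actual sector ground state;
refuting it needs such ground states for infinitely many `L` (Yang ODLRO in the doped Hubbard model —
open; `ρ₂`-eigenvalues of e.g. Slater determinants are `O(1)`, so nothing forces the antecedent).
Degenerate corners are all closed by the quantifiers: `L₀` is existential (small tori, where
`2⌊(1-δ)L²/2⌋ = L² - 2` can coincide with the two-hole sector, are skipped), `[NeZero L]` is supplied,
`δ₁` is ours. Symmetry cannot force falsity: `D₄` and translations transport sector ground states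
(`IsGroundStateInSector.fockMapOp_d4Orb_mulVec`, `IsGroundStateInSector.spaceGroup_mulVec`) and give the
selection rule `pairField_dWave_matrixElement_eq_zero` for MATRIX ELEMENTS of `Δ_d` between symmetry
eigenstates, but say nothing about which irreps carry the macroscopic eigenvectors of `ρ₂(ψ)` of an
(unknown) ground state; a non-`B₁g` macroscopic eigenvector would be orthogonal to `φ_d` only if one
knew it existed. So neither `stub-false` nor an unintended vacuity/`stub-misstated` arises; the
∃-form (lead c11) is degeneracy-safe as intended.

## (3) Diagnosis — `stub-blocked: none-in-tree`

No Literature `def … : Prop` or theorem implies the small-`c` case. Nearest tree items (none implies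
the stub): `hasPairFieldLRO_dWave_of_hasODLRO` (PROVED bridge; takes the overlap `c L² ≤ ‖⟨v, φ_d⟩‖²`
as HYPOTHESIS — the converse direction); `HasDWaveODLRO` (B₁g symmetry of `v`, no overlap clause; a
`B₁g` `v` may be `⟂ φ_d`); the open Summit cruxes `FluxSpectroscopy.OverlapNondegeneracy`
(stmt-1820: mirror-odd macroscopic eigenvectors have `‖⟨v, φ_d⟩‖² ≥ c' L²`, under flux hypotheses,
`c'` depending on the sequence) and `YangSpectral.YangDominantModeOverlap` (stmt-8621: the dominant
`B₁g` Rayleigh maximiser has n.n. `d`-weight) state the same "overlap non-degeneracy" physics but in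
forms that do not imply this stub (restricted eigenvectors / maximisers, sequence-dependent `c'`,
extra hypotheses). What would be needed: a finite-density condensate-structure theorem — for
`U ∈ [12,24]` and small `δ > 0`, every macroscopically occupied pair mode of every `(2⌊(1-δ)L²/2⌋, 0)`
sector ground state of `hubbardTorus 2 L 1 U` has `Θ(L²)` weight on the zero-momentum nearest-neighbour
`B₁g` bond function `φ_d` (non-fragmentation + `B₁g` + short pair size inherited from the two-hole bound
state; Scalapino 1995 §2, Dagotto RMP 66 §IV.C, PRB 55 6504 — numerics only, no theorem at any `U`).

References: C. N. Yang, Rev. Mod. Phys. 34 (1962) 694, §3–§4; D. J. Scalapino, Phys. Rep. 250 (1995)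
329, §2.
-/

set_option linter.dupNamespace false

noncomputable section

namespace Summit.HubbardSuperconductivity.HubbardSuperconductivity.Theorems.ParentFirstSMA

open Matrix Finset Filter
open Literature.Probability.LatticeModels Literature.MathematicalPhysics.QuantumLattice
open scoped ComplexOrder

/-- **Yang's ceiling on the `ρ₂`-eigenvalues of a sector ground state.** For a normalised
`(2⌊(1-δ)L²/2⌋, S^z = 0)` sector vector `ψ` on the torus of side `L` (`0 ≤ δ ≤ 1`) and a unit
eigenvector `ρ₂(ψ) v = ev • v`, `ev ≤ (1 - δ²) L²/2 + (1 - δ)`: Yang's bound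
`ev ≤ N(M - N + 2)/M` with `M = 2L²`, `N ≤ (1-δ)L² ≤ L² + 1` and monotonicity of `n ↦ n(M + 2 - n)`
on `[0, (M+2)/2]`. Yang, Rev. Mod. Phys. 34 (1962) 694, §3. [cite: Yang1962, §3] -/
theorem eigenvalue_twoParticleRDM_le_of_mem_szSector {L : ℕ} [NeZero L] {δ : ℝ} (hδ0 : 0 ≤ δ)
    (hδ1 : δ ≤ 1) {ψ : Fock (Orb (FermionTorus 2 L))} (hψ : star ψ ⬝ᵥ ψ = 1)
    (hmem : ψ ∈ szSector (Λ := FermionTorus 2 L) (2 * ⌊(1 - δ) * (L : ℝ) ^ 2 / 2⌋₊) 0)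
    {v : Orb (FermionTorus 2 L) × Orb (FermionTorus 2 L) → ℂ} {ev : ℝ} (hv : star v ⬝ᵥ v = 1)
    (hev : twoParticleRDM ψ *ᵥ v = (ev : ℂ) • v) :
    ev ≤ (1 - δ ^ 2) * (L : ℝ) ^ 2 / 2 + (1 - δ) := by
  classical
  set N : ℕ := 2 * ⌊(1 - δ) * (L : ℝ) ^ 2 / 2⌋₊ with hNdef
  have hNψ : IsNParticle N ψ := ((mem_szSector_iff _ _ ψ).1 hmem).1
  have hNeven : Even N := even_two_mul _
  -- `N ≤ (1-δ) L²` as reals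
  have hL2 : (0 : ℝ) ≤ (L : ℝ) ^ 2 := by positivity
  have hx0 : (0 : ℝ) ≤ (1 - δ) * (L : ℝ) ^ 2 / 2 := by
    have : (0 : ℝ) ≤ 1 - δ := by linarith
    positivity
  have hNle : (N : ℝ) ≤ (1 - δ) * (L : ℝ) ^ 2 := by
    have h := Nat.floor_le hx0
    rw [hNdef]; push_cast
    linarith
  -- the orbital count `M = 2L²`
  have hcardN : Fintype.card (Orb (FermionTorus 2 L)) = 2 * L ^ 2 := by
    rw [card_orb]; simp [FermionTorus, Fintype.card_lex]
  have hcard : (Fintype.card (Orb (FermionTorus 2 L)) : ℝ) = 2 * (L : ℝ) ^ 2 := by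
    rw [hcardN]; push_cast; ring
  have hNM : N ≤ Fintype.card (Orb (FermionTorus 2 L)) := by
    rw [hcardN]
    have h : (N : ℝ) ≤ 2 * (L : ℝ) ^ 2 := by nlinarith
    exact_mod_cast h
  -- Yang's bound at the unit eigenvector `v`
  have hY := twoParticleRDM_rayleigh_le_holds (ι := Orb (FermionTorus 2 L)) N hNeven hNM ψ hNψ hψ v
  have hlhs : (star v ⬝ᵥ (twoParticleRDM ψ *ᵥ v)).re = ev := by
    rw [hev, dotProduct_smul, hv, smul_eq_mul, mul_one, Complex.ofReal_re]
  have hrhs : (star v ⬝ᵥ v).re = 1 := by rw [hv, Complex.one_re]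
  rw [hlhs, hrhs, mul_one, hcard] at hY
  -- monotonicity of `n ↦ n (2L² + 2 - n)` up to `(1-δ)L² ≤ L² + 1`
  have hLpos : (0 : ℝ) < (L : ℝ) ^ 2 := by
    have : (0 : ℝ) < (L : ℝ) := by exact_mod_cast Nat.pos_of_ne_zero (NeZero.ne L)
    positivity
  have hN0 : (0 : ℝ) ≤ (N : ℝ) := by positivity
  have hmono : (N : ℝ) * (2 * (L : ℝ) ^ 2 - N + 2) ≤
      (1 - δ) * (L : ℝ) ^ 2 * (2 * (L : ℝ) ^ 2 - (1 - δ) * (L : ℝ) ^ 2 + 2) := by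
    -- `f(m) - f(n) = (m - n)(A - m - n) ≥ 0` with `A = 2L² + 2`, `m = (1-δ)L²`, `n = N`
    have h1 : 0 ≤ (1 - δ) * (L : ℝ) ^ 2 - N := by linarith
    have h2 : 0 ≤ 2 * (L : ℝ) ^ 2 + 2 - (1 - δ) * (L : ℝ) ^ 2 - N := by nlinarith
    nlinarith [mul_nonneg h1 h2]
  calc ev ≤ (N : ℝ) * (2 * (L : ℝ) ^ 2 - N + 2) / (2 * (L : ℝ) ^ 2) := hY
    _ ≤ (1 - δ) * (L : ℝ) ^ 2 * (2 * (L : ℝ) ^ 2 - (1 - δ) * (L : ℝ) ^ 2 + 2) / (2 * (L : ℝ) ^ 2) :=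
        div_le_div_of_nonneg_right hmono (by positivity)
    _ = (1 - δ ^ 2) * (L : ℝ) ^ 2 / 2 + (1 - δ) := by
        have hL0 : (L : ℝ) ≠ 0 := by exact_mod_cast (NeZero.ne L)
        field_simp
        ring

/-- **The vacuous regime of `stub_condensateDWaveLocking` (Yang threshold).** For `0 ≤ δ ≤ 1` and
every threshold `c > (1 - δ²)/2` the body of the stub holds with `c' = 1`, because by
`eigenvalue_twoParticleRDM_le_of_mem_szSector` no unit `ρ₂`-eigenvector of a normalised
`(2⌊(1-δ)L²/2⌋, S^z = 0)` sector vector has eigenvalue `≥ c L²` once `(c - (1-δ²)/2) L > 1`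
(the antecedent is unsatisfiable). In particular every `c > 1/2` is vacuous for all `δ ∈ [0, 1]`;
for `c ≤ (1-δ²)/2` Yang's bound is silent. Yang, Rev. Mod. Phys. 34 (1962) 694, §3.
[cite: Yang1962, §3] -/
theorem condensateDWaveLocking_of_yang_threshold (U : ℝ) {δ : ℝ} (hδ0 : 0 ≤ δ) (hδ1 : δ ≤ 1)
    {c : ℝ} (hc : (1 - δ ^ 2) / 2 < c) :
    ∃ c' : ℝ, 0 < c' ∧ ∃ L₀ : ℕ, ∀ (L : ℕ) [NeZero L], L₀ ≤ L → Even L →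
      ∀ ψ : Fock (Orb (FermionTorus 2 L)), star ψ ⬝ᵥ ψ = 1 →
        IsGroundStateInSector (hubbardTorus 2 L 1 U) (2 * ⌊(1 - δ) * (L : ℝ) ^ 2 / 2⌋₊) 0 ψ →
          (∃ v : Orb (FermionTorus 2 L) × Orb (FermionTorus 2 L) → ℂ, ∃ ev : ℝ,
              star v ⬝ᵥ v = 1 ∧ twoParticleRDM ψ *ᵥ v = (ev : ℂ) • v ∧ c * (L : ℝ) ^ 2 ≤ ev) →
            ∃ v : Orb (FermionTorus 2 L) × Orb (FermionTorus 2 L) → ℂ, ∃ ev : ℝ,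
              star v ⬝ᵥ v = 1 ∧ twoParticleRDM ψ *ᵥ v = (ev : ℂ) • v ∧ c * (L : ℝ) ^ 2 ≤ ev ∧
                c' * (L : ℝ) ^ 2 ≤ ‖star v ⬝ᵥ pairFieldWavefunction dWaveFormFactor L‖ ^ 2 := by
  set ε : ℝ := c - (1 - δ ^ 2) / 2 with hε
  have hεpos : 0 < ε := by rw [hε]; linarith
  obtain ⟨L₀, hL₀⟩ := exists_nat_gt (1 / ε)
  refine ⟨1, one_pos, L₀, fun L _ hL _ ψ hψ hGS hant => ?_⟩
  exfalso
  obtain ⟨v, ev, hv, hev, hcL⟩ := hant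
  have hle := eigenvalue_twoParticleRDM_le_of_mem_szSector hδ0 hδ1 hψ hGS.1 hv hev
  -- `ε L² ≥ ε L > 1 ≥ 1 - δ`
  have hLr : (L₀ : ℝ) ≤ (L : ℝ) := by exact_mod_cast hL
  have hLgt : 1 / ε < (L : ℝ) := lt_of_lt_of_le hL₀ hLr
  have hεL : 1 < ε * (L : ℝ) := by
    have h := (div_lt_iff₀ hεpos).1 hLgt
    linarith [mul_comm (L : ℝ) ε]
  have hL1 : (1 : ℝ) ≤ (L : ℝ) := by
    have h0 : (0 : ℝ) < (L : ℝ) := lt_trans (by positivity) hLgt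
    have h1 : (1 : ℕ) ≤ L := Nat.one_le_iff_ne_zero.2 (by
      rintro rfl
      simp at h0)
    exact_mod_cast h1
  have hεL2 : 1 - δ < ε * (L : ℝ) ^ 2 := by
    have : ε * (L : ℝ) ≤ ε * (L : ℝ) ^ 2 := by
      have hsq : (L : ℝ) ≤ (L : ℝ) ^ 2 := by nlinarith
      exact mul_le_mul_of_nonneg_left hsq hεpos.le
    linarith
  -- contradiction: `c L² ≤ ev ≤ (1-δ²)L²/2 + (1-δ) < (1-δ²)L²/2 + ε L² = c L²`
  have : c * (L : ℝ) ^ 2 = (1 - δ ^ 2) * (L : ℝ) ^ 2 / 2 + ε * (L : ℝ) ^ 2 := by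
    rw [hε]; ring
  linarith

/-- **Registered form (lead c14) of the Yang-threshold lemma.** For `0 ≤ δ ≤ 1` and every threshold
`c > (1 - δ²)/2` the body of `stub_condensateDWaveLocking` holds at `(U, δ, c)` with `c' = 1`, vacuously:
no normalised `(2⌊(1-δ)L²/2⌋, S^z = 0)` sector vector has a unit `ρ₂`-eigenvector with eigenvalue
`≥ c L²` for large `L` (Yang's ceiling). The stub is contentful only for `0 < c ≤ (1 - δ²)/2`.
(`condensateDWaveLocking_of_yang_threshold` in closed arrow form.) Yang, Rev. Mod. Phys. 34 (1962)
694, §3. [cite: Yang1962, §3] -/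
theorem condensateDWaveLocking_vacuous_above_yang : ∀ U δ : ℝ, 0 ≤ δ → δ ≤ 1 → ∀ c : ℝ, (1 - δ ^ 2) / 2 < c → ∃ c' : ℝ, 0 < c' ∧ ∃ L₀ : ℕ, ∀ (L : ℕ) [NeZero L], L₀ ≤ L → Even L → ∀ ψ : Fock (Orb (FermionTorus 2 L)), star ψ ⬝ᵥ ψ = 1 → IsGroundStateInSector (hubbardTorus 2 L 1 U) (2 * ⌊(1 - δ) * (L : ℝ) ^ 2 / 2⌋₊) 0 ψ → (∃ v : Orb (FermionTorus 2 L) × Orb (FermionTorus 2 L) → ℂ, ∃ ev : ℝ, star v ⬝ᵥ v = 1 ∧ twoParticleRDM ψ *ᵥ v = (ev : ℂ) • v ∧ c * (L : ℝ) ^ 2 ≤ ev) → ∃ v : Orb (FermionTorus 2 L) × Orb (FermionTorus 2 L) → ℂ, ∃ ev : ℝ, star v ⬝ᵥ v = 1 ∧ twoParticleRDM ψ *ᵥ v = (ev : ℂ) • v ∧ c * (L : ℝ) ^ 2 ≤ ev ∧ c' * (L : ℝ) ^ 2 ≤ ‖star v ⬝ᵥ pairFieldWavefunction dWaveFormFactor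 L‖ ^ 2 :=
  fun U _ h0 h1 _ hc => condensateDWaveLocking_of_yang_threshold U h0 h1 hc

end Summit.HubbardSuperconductivity.HubbardSuperconductivity.Theorems.ParentFirstSMA

end
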